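/-
Copyright: the b2b-balaban T⁴-continuum CRUX team, row NE7b leaf lineage `t4-ne7b-formalise-leaf-03` (gen 149). Project licence.
-/
import Mathlib.Analysis.Calculus.FDeriv.Symmetric
import Mathlib.Analysis.Normed.Operator.Bilinear

/-!
# THE HARD-STEP LETTERS ALREADY MAKE THE HESSIAN SYMMETRIC: `DifferentiableAt V` on a ball + `HasFDerivAt (fderiv V) (V″x) x` give
# `V″x v w = V″x w v` at every INTERIOR point (Schwarz — Mathlib `second_derivative_symmetric_of_eventually_of_real`), for the action
# AND for a nonlinear constraint `G`; hence the Lagrangian form `V″ − λ ∘ G″` is symmetric and `…TwoScaleLetterConverse` (TSLC)'s second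
# orthogonality letter is the first one; and the NEXT Hessian `D²V⁺(w)` of `…HardStepInductiveStep` ∕ `…HardStepKKTInductiveStep` (c) is
# symmetric from their blocks (b)–(c) alone (row NE7b, node U5c; the NOT-HERE «symmetry … not assumed» of AHE ∕ HKAH ∕ HKIS ∕ TSLC
# discharged from letters the chain displays; Mathlib only; [folklore])

Cell `pub-balaban`, sub-cell `t4`, spine estimate NE7b (`T4WeightBudget.RelWeightBound`; the cell's OWN estimate — NOT PRINTED in
[Bałaban 1983–89], NOT PROVED).  Crux-route work under `Spine/NE7b/` by leaf-03 (CRUX team (2), FREEZE (0) crux-prover clause).  NOTHING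
of Bałaban's is named, asserted, valued or discharged; no `T4Continuum/Support` leaf typed; no `def`; zero `sorry`.  Imports Mathlib ONLY
(`FDeriv.Symmetric`, `Normed.Operator.Bilinear`) — independent of the `Spine/NE7b` olean frontier; HSIS ∕ HKIS ∕ TSLC ∕ HKAH are NOT
imported: their letter SHAPES enter as hypotheses, their names only in this docstring.

WHY.  Several files of the hard-step chain say «no symmetry assumed» (AHE: «symmetric-`Q` refinements NOT HERE»; HKAH: «symmetry of
`λ′(w)` … not assumed»; HKIS: «symmetry of `D²V⁺` NOT HERE»; TSLC: «for a symmetric `Q` either orthogonality letter gives the other —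
no symmetry assumed»).  But the chain's own INPUT letters — `V` differentiable on `closedBall δ₀ r` (`hVd`) and
`HasFDerivAt (fderiv V) (V″x) x` there (`hV`), `0 < r` — already force `V″x` to be SYMMETRIC at every point of the OPEN ball (Schwarz
in Fréchet form: differentiability NEAR `x` + a second derivative AT `x`), and likewise `G″x` for the nonlinear constraint's
letters (`hG`, `hG′`); so the Lagrangian form `𝓛_x = V″x − compL λ ∘ G″x` is symmetric, TSLC's two orthogonality letters collapse to
one (which HKIS (a)(vii) ∕ TSLC §2b supply), and the next Hessian `D²V⁺(w)` is symmetric from the step's OUTPUT blocks (b)–(c)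
(`V⁺` differentiable on the open chart ball, `HasFDerivAt (fderiv V⁺) (Q⁺ w) w`).  No letter is added to the tower; one is removed.

WHAT IS PROVED ([folklore]; Schwarz ∕ Clairaut in Fréchet form — Mathlib `second_derivative_symmetric_of_eventually_of_real`; `E`, `F`,
`Y` real normed spaces).
* §1 **`symm_of_differentiableOn_open`** — `U` open, `f : E → Y` differentiable at every point of `U`, `HasFDerivAt (fderiv f) f″ x` at
  `x ∈ U` ⟹ `f″ v w = f″ w v`; **`symm_on_ball_of_letters`** — HSIS's letter shape: `hVd ∕ hV` on `closedBall δ₀ r` ⟹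
  `∀ x ∈ ball δ₀ r, V″x v w = V″x w v` (in particular at the centre when `0 < r`: `symm_centre_of_letters`).
* §2 THE PRIMAL–DUAL SHAPE (HKB ∕ HKIS letters live on `closedBall x₀ r ⊆ E × (F →L ℝ)` and speak of `x.1`):
  **`symm_on_ball_of_letters_fst`** — `∀ x ∈ closedBall x₀ r, DifferentiableAt f x.1` + `HasFDerivAt (fderiv f) (f″ x.1) x.1` ⟹
  `∀ x ∈ ball x₀ r, f″ x.1` symmetric (the first shadow of the open sup-norm ball is open around `x.1`: lift `y ↦ (y, x.2)`).
* §3 THE LAGRANGIAN FORM: **`lagrangian_symm`** — `P v w = P w v`, `C v w = C w v` (as vectors of `F`) ⟹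
  `(P − compL λ ∘ C) v w = (P − compL λ ∘ C) w v`; **`lagrangian_symm_of_letters_fst`** — from HKIS's four letters `hVd, hV, hG, hG′` on
  the primal–dual ball: the moving Lagrangian form `V″x.1 − compL μ ∘ G″x.1` is symmetric at every interior `x`, for ANY multiplier `μ`.
* §4 TSLC's JUNCTION: **`orth_both_of_symm_letters`** — a symmetric `Q` and the first orthogonality letter `D κ = 0 → Q (S k) κ = 0` give
  both letters (TSLC `orth_letters_of_symm`'s shape, restated on the letter level so that no import is needed — one line).
* §5 THE NEXT SCALE: **`nextHessian_symm_of_blocks`** — HSIS ∕ HKIS output shape: `∀ w ∈ ball c ρ, DifferentiableAt V⁺ w` (block (b)) and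
  `HasFDerivAt (fderiv V⁺) Q⁺ w₁` at `w₁ ∈ ball c ρ` (block (c)) ⟹ `Q⁺ k k′ = Q⁺ k′ k`.
* §6 toy: `V = ½‖·‖²` on a real inner-product space is its own witness (`V″ = ⟪·,·⟫`, symmetric) — here the cheaper kernel toy
  `f = 0` on `ℝ` (`f″ = 0`).

NOT HERE (honest): symmetry ON THE BOUNDARY sphere of the closed ball (not claimed, not needed — the chain's conclusions live on open
balls); anything quantitative; which `V, G` are Bałaban's ((A3) ∕ (A1c), NC-NE7b-α UNRULED).  BY-NAME EFFECT ON THE WALL: NONE.  NE7b NOT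
PRINTED ∕ NOT PROVED; spine PROVED 0∕9; rung (B)+1 on a FINITE torus — NOT infinite volume, NOT the mass gap, NOT Clay.  HONEST DEPENDENCY:
continuum YM on T⁴ ⇐ BetaPertH ∧ nine spine estimates (0/9 proved); BetaPertH ⇐ (D1) ∧ (D4) ∧ CAP+tail; G-an2-4 gates asym, D1 and NE2∕3∕4.
-/

set_option autoImplicit false

namespace Summit.QuantumFields.BalabanUV.T4Continuum.NE7b.HessianSymmetryLetters

open Set Filter Topology Metric

variable {E F Y : Type*} [NormedAddCommGroup E] [NormedSpace ℝ E] [NormedAddCommGroup F] [NormedSpace ℝ F]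
  [NormedAddCommGroup Y] [NormedSpace ℝ Y]

/-! ## §1. Schwarz from the letters: a derivative family near the point + a second derivative at the point -/

/-- **SYMMETRY AT AN INTERIOR POINT**: `U` open, `HasFDerivAt f (f′ y) y` for every `y ∈ U`, `HasFDerivAt f′ f″ x` at `x ∈ U` ⟹
`f″ v w = f″ w v`. [folklore] (Schwarz; Mathlib `second_derivative_symmetric_of_eventually_of_real`) -/
theorem symm_of_letters_open {f : E → Y} {f' : E → E →L[ℝ] Y} {U : Set E} (hU : IsOpen U)
    (hf : ∀ y ∈ U, HasFDerivAt f (f' y) y) {x : E} (hx : x ∈ U) {f'' : E →L[ℝ] E →L[ℝ] Y} (h2 : HasFDerivAt f' f'' x)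
    (v w : E) : f'' v w = f'' w v :=
  second_derivative_symmetric_of_eventually_of_real (Filter.eventually_of_mem (hU.mem_nhds hx) hf) h2 v w

/-- The `fderiv` currency: `U` open, `f` differentiable at every point of `U`, `HasFDerivAt (fderiv f) f″ x` at `x ∈ U` ⟹ `f″` symmetric.
[folklore] -/
theorem symm_of_differentiableOn_open {f : E → Y} {U : Set E} (hU : IsOpen U) (hd : ∀ y ∈ U, DifferentiableAt ℝ f y)
    {x : E} (hx : x ∈ U) {f'' : E →L[ℝ] E →L[ℝ] Y} (h2 : HasFDerivAt (fderiv ℝ f) f'' x) (v w : E) :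
    f'' v w = f'' w v :=
  symm_of_letters_open hU (fun y hy => (hd y hy).hasFDerivAt) hx h2 v w

/-- **HSIS's LETTER SHAPE**: `V` differentiable on `closedBall δ₀ r` and `HasFDerivAt (fderiv V) (V″x) x` there ⟹ `V″x` is symmetric at
every point of the OPEN ball. [folklore] -/
theorem symm_on_ball_of_letters {V : E → Y} {V'' : E → E →L[ℝ] E →L[ℝ] Y} {δ₀ : E} {r : ℝ}
    (hVd : ∀ x ∈ closedBall δ₀ r, DifferentiableAt ℝ V x) (hV : ∀ x ∈ closedBall δ₀ r, HasFDerivAt (fderiv ℝ V) (V'' x) x) :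
    ∀ x ∈ ball δ₀ r, ∀ v w, V'' x v w = V'' x w v := fun x hx v w =>
  symm_of_differentiableOn_open isOpen_ball (fun y hy => hVd y (ball_subset_closedBall hy)) hx
    (hV x (ball_subset_closedBall hx)) v w

/-- In particular AT THE CENTRE (`0 < r`): `V″δ₀` — AHE's `Q`, HSIS's kernel-coercive form — is symmetric. [folklore] -/
theorem symm_centre_of_letters {V : E → Y} {V'' : E → E →L[ℝ] E →L[ℝ] Y} {δ₀ : E} {r : ℝ} (hr : 0 < r)
    (hVd : ∀ x ∈ closedBall δ₀ r, DifferentiableAt ℝ V x) (hV : ∀ x ∈ closedBall δ₀ r, HasFDerivAt (fderiv ℝ V) (V'' x) x) :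
    ∀ v w, V'' δ₀ v w = V'' δ₀ w v :=
  symm_on_ball_of_letters hVd hV δ₀ (mem_ball_self hr)

/-! ## §2. The primal–dual shape (letters on `closedBall x₀ r ⊆ E × W`, about `x.1`) -/

omit [NormedSpace ℝ E] in
/-- Lifting the first shadow: for `x ∈ ball x₀ r` and `dist y x.1 < r − dist x x₀`, the point `(y, x.2)` lies in `closedBall x₀ r`. -/
theorem lift_mem_closedBall {W : Type*} [NormedAddCommGroup W] {x₀ x : E × W} {r : ℝ} {y : E}
    (hy : dist y x.1 < r - dist x x₀) : ((y, x.2) : E × W) ∈ closedBall x₀ r := by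
  rw [mem_closedBall]
  have h1 : dist ((y, x.2) : E × W) x ≤ dist y x.1 := by
    rw [Prod.dist_eq, dist_self]
    exact max_le le_rfl dist_nonneg
  have h3 := dist_triangle ((y, x.2) : E × W) x x₀
  linarith

/-- **THE PRIMAL–DUAL LETTER SHAPE** (HKB ∕ KCDM ∕ HKIS): on `closedBall x₀ r ⊆ E × W` (sup norm) the letters `HasFDerivAt f (f′ x.1) x.1`
and `HasFDerivAt f′ (f″ x.1) x.1` ⟹ `f″ x.1` is symmetric for every `x` in the OPEN ball (take `f′ := fderiv V` with the differentiability
letter for the action, `f′ := G′` for the constraint). [folklore] -/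
theorem symm_of_letters_fst {W : Type*} [NormedAddCommGroup W] [NormedSpace ℝ W]
    {f : E → Y} {f' : E → E →L[ℝ] Y} {f'' : E → E →L[ℝ] E →L[ℝ] Y} {x₀ : E × W} {r : ℝ}
    (hf : ∀ x ∈ closedBall x₀ r, HasFDerivAt f (f' x.1) x.1) (h2 : ∀ x ∈ closedBall x₀ r, HasFDerivAt f' (f'' x.1) x.1) :
    ∀ x ∈ ball x₀ r, ∀ v w, f'' x.1 v w = f'' x.1 w v := by
  intro x hx v w
  have hρ : 0 < r - dist x x₀ := sub_pos.2 (mem_ball.1 hx)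
  exact symm_of_letters_open (U := ball x.1 (r - dist x x₀)) isOpen_ball
    (fun y hy => hf (y, x.2) (lift_mem_closedBall (mem_ball.1 hy))) (mem_ball_self hρ) (h2 x (ball_subset_closedBall hx)) v w

/-- The action's version in HKIS's exact letters (`DifferentiableAt V x.1`, `HasFDerivAt (fderiv V) (V″x.1) x.1`). [folklore] -/
theorem symm_of_letters_fst' {W : Type*} [NormedAddCommGroup W] [NormedSpace ℝ W]
    {V : E → Y} {V'' : E → E →L[ℝ] E →L[ℝ] Y} {x₀ : E × W} {r : ℝ}
    (hVd : ∀ x ∈ closedBall x₀ r, DifferentiableAt ℝ V x.1) (hV : ∀ x ∈ closedBall x₀ r, HasFDerivAt (fderiv ℝ V) (V'' x.1) x.1) :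
    ∀ x ∈ ball x₀ r, ∀ v w, V'' x.1 v w = V'' x.1 w v :=
  symm_of_letters_fst (f' := fderiv ℝ V) (fun x hx => (hVd x hx).hasFDerivAt) hV

/-! ## §3. The Lagrangian form is symmetric -/

/-- `(P − compL λ ∘ C) v w = (P − compL λ ∘ C) w v` when `P` and `C` are symmetric. [folklore] -/
theorem lagrangian_symm (P : E →L[ℝ] E →L[ℝ] ℝ) (C : E →L[ℝ] E →L[ℝ] F) (lam : F →L[ℝ] ℝ)
    (hP : ∀ v w, P v w = P w v) (hC : ∀ v w, C v w = C w v) (v w : E) :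
    (P - ((ContinuousLinearMap.compL ℝ E F ℝ) lam).comp C) v w = (P - ((ContinuousLinearMap.compL ℝ E F ℝ) lam).comp C) w v := by
  have e : ∀ a b : E, (P - ((ContinuousLinearMap.compL ℝ E F ℝ) lam).comp C) a b = P a b - lam (C a b) := fun a b => rfl
  rw [e, e, hP v w, hC v w]

/-- **THE MOVING LAGRANGIAN FORM IS SYMMETRIC FROM HKIS's FOUR LETTERS**: on the primal–dual ball, `HasFDerivAt G (G′x.1) x.1`,
`HasFDerivAt G′ (G″x.1) x.1`, `DifferentiableAt V x.1`, `HasFDerivAt (fderiv V) (V″x.1) x.1` ⟹ for every `x` in the OPEN ball and EVERY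
multiplier `μ`: `(V″x.1 − compL μ ∘ G″x.1) v w = (…) w v`. [folklore] -/
theorem lagrangian_symm_of_letters_fst {G : E → F} {G' : E → E →L[ℝ] F} {G'' : E → E →L[ℝ] E →L[ℝ] F}
    {V : E → ℝ} {V'' : E → E →L[ℝ] E →L[ℝ] ℝ} {x₀ : E × (F →L[ℝ] ℝ)} {r : ℝ}
    (hG : ∀ x ∈ closedBall x₀ r, HasFDerivAt G (G' x.1) x.1) (hG' : ∀ x ∈ closedBall x₀ r, HasFDerivAt G' (G'' x.1) x.1)
    (hVd : ∀ x ∈ closedBall x₀ r, DifferentiableAt ℝ V x.1) (hV : ∀ x ∈ closedBall x₀ r, HasFDerivAt (fderiv ℝ V) (V'' x.1) x.1) :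
    ∀ x ∈ ball x₀ r, ∀ (μ : F →L[ℝ] ℝ) (v w : E),
      (V'' x.1 - ((ContinuousLinearMap.compL ℝ E F ℝ) μ).comp (G'' x.1)) v w =
        (V'' x.1 - ((ContinuousLinearMap.compL ℝ E F ℝ) μ).comp (G'' x.1)) w v :=
  fun x hx μ v w =>
    lagrangian_symm (V'' x.1) (G'' x.1) μ (symm_of_letters_fst' hVd hV x hx) (symm_of_letters_fst hG hG' x hx) v w

/-! ## §4. TSLC's junction: one orthogonality letter is both -/

/-- **BOTH ORTHOGONALITY LETTERS FROM ONE** for a symmetric form (TSLC `orth_letters_of_symm`'s shape, letter level). [folklore] -/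
theorem orth_both_of_symm_letters {Q : E →L[ℝ] E →L[ℝ] ℝ} (hsymm : ∀ v w, Q v w = Q w v) {D : E →L[ℝ] F} {S : F →L[ℝ] E}
    (h : ∀ k κ, D κ = 0 → Q (S k) κ = 0) : ∀ k κ, D κ = 0 → Q (S k) κ = 0 ∧ Q κ (S k) = 0 :=
  fun k κ hκ => ⟨h k κ hκ, by rw [hsymm]; exact h k κ hκ⟩

/-! ## §5. The next scale: `D²V⁺(w)` is symmetric from the step's output blocks -/

/-- **THE NEXT HESSIAN IS SYMMETRIC** (HSIS ∕ HKIS output shape): `V⁺` differentiable at every point of the open chart ball `ball c ρ`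
(block (b)) and `HasFDerivAt (fderiv V⁺) Q⁺ w` at `w ∈ ball c ρ` (block (c)) ⟹ `Q⁺ k k′ = Q⁺ k′ k`. [folklore] -/
theorem nextHessian_symm_of_blocks {X : Type*} [NormedAddCommGroup X] [NormedSpace ℝ X] {Vn : X → ℝ} {c : X} {ρ : ℝ}
    (hb : ∀ w ∈ ball c ρ, DifferentiableAt ℝ Vn w) {w : X} (hw : w ∈ ball c ρ) {Qn : X →L[ℝ] X →L[ℝ] ℝ}
    (hc : HasFDerivAt (fderiv ℝ Vn) Qn w) : ∀ k k', Qn k k' = Qn k' k :=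
  symm_of_differentiableOn_open isOpen_ball hb hw hc

/-! ## §6. Toy -/

/-- Toy: `f = 0` on `ℝ` with `f′ ≡ 0`, `f″ = 0` on the open set `univ` — §1 fires (`0 = 0`). -/
example (v w : ℝ) : (0 : ℝ →L[ℝ] ℝ →L[ℝ] ℝ) v w = (0 : ℝ →L[ℝ] ℝ →L[ℝ] ℝ) w v :=
  symm_of_letters_open (f := fun _ : ℝ => (0 : ℝ)) (f' := fun _ => (0 : ℝ →L[ℝ] ℝ)) (U := univ) isOpen_univ
    (fun y _ => hasFDerivAt_const (0 : ℝ) y) (mem_univ (0 : ℝ)) (hasFDerivAt_const _ _) v w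

end Summit.QuantumFields.BalabanUV.T4Continuum.NE7b.HessianSymmetryLetters
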